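/-
Copyright (c) 2026 the pub-hodgecm-mathlib formalisation cell (harness21).  Prover seat hodgecm-mathlib-K2E5-p16 (g7), Track B «K2-LIT»,
#184♮ = hLiu418 = `stmt-HodgeConjecture-24832`; S2-asm road (γ) packaging, FRAME BLOCK FILE 5 (K2Liu-p05 (g6) desk 15:21:01Z «(F2)»): the ring half —
the tube frame conjugates the WHOLE Cayley chart `T₁ M ½T₁′` to a scaled relabelling of `M`: `T⁻¹ (T₁ M ½T₁′) T = (d_{q}∕d_{p}) · M(π p, π q)` with the slot involution
`π` (swap `inl i ↔ inr i` exactly when `t_i < 0`).  THEOREMS ONLY (no `def`, no `instance`, no notation, no `sorry`).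
-/
import Summits.HodgeConjecture.HodgeConjecture.Theorems.K2LiuHermitianTubeFrameSign   -- ★ FILE 1: `frameInv_mul_cayley`, `cayleyInv_mul_frame`, the diagonal letters
import HarnessLib

/-!
# Crux `HLiu418`, Road (γ) frame block FILE 5 (ring half of (F2)): `T⁻¹ (T₁ M ½T₁′) T` is `M` relabelled by the slot involution and rescaled

Cell `hodgecm-mathlib`, crux item hLiu418 = `stmt-HodgeConjecture-24832` (helper lane `--supports`, count-neutral).

With the Shimura letters of `t` (★ `K2LiuHermitianTubeFrame` §3; `d_i = √(|t_i|∕2)`, `e_i = t_i∕|t_i|`) and the Cayley unit `T₁`, the matrix `S := ½T₁′ T` is a SCALED PERMUTATION: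
`S e_q = d_{q̄} e_{π q}` for the involution `π` of `l ⊕ l` swapping `inl i ↔ inr i` exactly when `t_i < 0` (`q̄` the underlying index), and `T⁻¹ T₁ = S⁻¹` likewise.  Hence for
EVERY `M` (not only the compact chart `diag(k₁,k₂)` of ★ FILE 1 §3): `T⁻¹ (T₁ M ½T₁′) T = S⁻¹ M S` has entries `d_{p̄}⁻¹ · M(π p, π q) · d_{q̄}`.
* §1 `cayleyInv_mul_frame_eq_perm`, `frameInv_mul_cayley_eq_perm` — the two scaled permutations, entrywise;
* §2 **`frameInv_cayley_conj_frame`** — the displayed formula.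
The arch half of (F2) (`archPiEquivCM⁻¹ (δ_w (ι_w (T₁ M ½T₁′))) = placeSec σ h` with the matrix of `h` equal to `M` relabelled by `π` through the sign frame — the scalings
cancel against `scaleConj (sqrtAbs x_σ)`) is FILE 5b; the (der) consumer is ★ p05 `hcurve_of_frame` (D1).
References: [Shimura1997, §§5–6 (Case UT), §6.5]; [KonnoKonno2007, §3.1]; [Folland1989, §4.2 Prop. (4.39)].
HONEST LABEL: HC_CM is proved only modulo the 7 printed citations (2 remaining named inputs: hLiu418 = stmt-HodgeConjecture-24832,
h413 = stmt-HodgeConjecture-24833) until rung 0 closes; count-neutral helper, closes no socket.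
-/

set_option autoImplicit false
set_option linter.dupNamespace false

namespace Summit.HodgeConjecture.HodgeConjecture.Cruxes.HLiu418.K2LiuArchReadingChartPlaceSec

open Matrix Complex
open scoped ComplexConjugate
open K2LiuHermitianTubeCocycle K2LiuHermitianTubeFrame K2LiuHermitianTubeFrameSign

variable {l : Type*} [Fintype l] [DecidableEq l]

/-! ## §1 The two scaled permutations -/

omit [Fintype l] [DecidableEq l] in
/-- `(1 + e_i)·x = 2x` or `0` according to the sign of `t_i` (`e_i = t_i∕|t_i|`). [folklore] -/
theorem one_add_sign_mul (t : l → ℝ) (ht : ∀ i, t i ≠ 0) (i : l) (x : ℝ) :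
    (((1 + t i / |t i|) * x : ℝ) : ℂ) = if 0 < t i then 2 * (x : ℂ) else 0 := by
  by_cases hi : 0 < t i
  · rw [sign_letter_of_pos hi, if_pos hi]; push_cast; ring
  · rw [sign_letter_of_not_pos (ht i) hi, if_neg hi]; push_cast; ring

omit [Fintype l] [DecidableEq l] in
/-- `(1 − e_i)·x = 0` or `2x` according to the sign of `t_i`. [folklore] -/
theorem one_sub_sign_mul (t : l → ℝ) (ht : ∀ i, t i ≠ 0) (i : l) (x : ℝ) :
    (((1 - t i / |t i|) * x : ℝ) : ℂ) = if 0 < t i then 0 else 2 * (x : ℂ) := by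
  by_cases hi : 0 < t i
  · rw [sign_letter_of_pos hi, if_pos hi]; push_cast; ring
  · rw [sign_letter_of_not_pos (ht i) hi, if_neg hi]; push_cast; ring

/-- **`½T₁′ · T` IS A SCALED PERMUTATION**: `(½T₁′ T)_{pq} = d_{q̄}` if `p = π q` and `0` otherwise, `π (inl i) = inl i ∕ inr i` and `π (inr i) = inr i ∕ inl i` according as
`0 < t_i` or not (★ FILE 1 `cayleyInv_mul_frame` + the diagonal letters `D ∓ iC₀ = diag((1±e)d)`). [cite: Shimura1997, §6.5] -/
theorem cayleyInv_mul_frame_eq_perm (t : l → ℝ) (ht : ∀ i, t i ≠ 0) :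
    ((2 : ℂ)⁻¹ • fromBlocks 1 (-(I • 1)) 1 (I • 1) : Matrix (l ⊕ l) (l ⊕ l) ℂ) *
        fromBlocks (diagonal (fun i => (Real.sqrt (|t i| / 2) : ℂ))) (diagonal (fun i => (Real.sqrt (|t i| / 2) : ℂ)))
          (diagonal (fun i => I * (((t i / |t i|) * Real.sqrt (|t i| / 2) : ℝ) : ℂ))) (-diagonal (fun i => I * (((t i / |t i|) * Real.sqrt (|t i| / 2) : ℝ) : ℂ))) =
      Matrix.of fun p q : l ⊕ l =>
        if p = Sum.elim (fun i => if 0 < t i then (Sum.inl i : l ⊕ l) else Sum.inr i) (fun i => if 0 < t i then (Sum.inr i : l ⊕ l) else Sum.inl i) q then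
          (Real.sqrt (|t (Sum.elim id id q)| / 2) : ℂ) else 0 := by
  rw [cayleyInv_mul_frame, letters_D_sub_I_C₀, letters_D_add_I_C₀, fromBlocks_smul]
  ext p q
  rcases p with i | i <;> rcases q with j | j <;>
    simp only [fromBlocks_apply₁₁, fromBlocks_apply₁₂, fromBlocks_apply₂₁, fromBlocks_apply₂₂, Matrix.smul_apply, diagonal_apply, Matrix.of_apply,
      Sum.elim_inl, Sum.elim_inr, id, smul_eq_mul] <;>
    by_cases hij : i = j
  · subst hij
    rw [if_pos rfl, one_add_sign_mul t ht]
    by_cases hi : 0 < t i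
    · rw [if_pos hi, if_pos hi, if_pos rfl]; ring
    · rw [if_neg hi, if_neg hi, if_neg Sum.inl_ne_inr, mul_zero]
  · rw [if_neg hij, mul_zero]
    by_cases hj : 0 < t j
    · rw [if_pos hj, if_neg (fun h => hij (Sum.inl_injective h))]
    · rw [if_neg hj, if_neg Sum.inl_ne_inr]
  · subst hij
    rw [if_pos rfl, one_sub_sign_mul t ht]
    by_cases hi : 0 < t i
    · rw [if_pos hi, if_pos hi, if_neg Sum.inl_ne_inr, mul_zero]
    · rw [if_neg hi, if_neg hi, if_pos rfl]; ring
  · rw [if_neg hij, mul_zero]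
    by_cases hj : 0 < t j
    · rw [if_pos hj, if_neg Sum.inl_ne_inr]
    · rw [if_neg hj, if_neg (fun h => hij (Sum.inl_injective h))]
  · subst hij
    rw [if_pos rfl, one_sub_sign_mul t ht]
    by_cases hi : 0 < t i
    · rw [if_pos hi, if_pos hi, if_neg Sum.inr_ne_inl, mul_zero]
    · rw [if_neg hi, if_neg hi, if_pos rfl]; ring
  · rw [if_neg hij, mul_zero]
    by_cases hj : 0 < t j
    · rw [if_pos hj, if_neg Sum.inr_ne_inl]
    · rw [if_neg hj, if_neg (fun h => hij (Sum.inr_injective h))]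
  · subst hij
    rw [if_pos rfl, one_add_sign_mul t ht]
    by_cases hi : 0 < t i
    · rw [if_pos hi, if_pos hi, if_pos rfl]; ring
    · rw [if_neg hi, if_neg hi, if_neg Sum.inr_ne_inl, mul_zero]
  · rw [if_neg hij, mul_zero]
    by_cases hj : 0 < t j
    · rw [if_pos hj, if_neg (fun h => hij (Sum.inr_injective h))]
    · rw [if_neg hj, if_neg Sum.inr_ne_inl]

/-- **`T⁻¹ · T₁` IS THE INVERSE SCALED PERMUTATION**: `(T⁻¹ T₁)_{pq} = d_{p̄}⁻¹` if `q = π p` and `0` otherwise (★ FILE 1 `frameInv_mul_cayley` + the letters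
`P₀ ∓ iP₁ = diag((1±e)d⁻¹∕2)`). [cite: Shimura1997, §6.5] -/
theorem frameInv_mul_cayley_eq_perm (t : l → ℝ) (ht : ∀ i, t i ≠ 0) :
    fromBlocks (diagonal (fun i => (((Real.sqrt (|t i| / 2))⁻¹ / 2 : ℝ) : ℂ))) (-diagonal (fun i => I * ((((Real.sqrt (|t i| / 2))⁻¹ * (t i / |t i|) / 2 : ℝ) : ℂ))))
        (diagonal (fun i => (((Real.sqrt (|t i| / 2))⁻¹ / 2 : ℝ) : ℂ))) (diagonal (fun i => I * ((((Real.sqrt (|t i| / 2))⁻¹ * (t i / |t i|) / 2 : ℝ) : ℂ)))) *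
        (fromBlocks 1 1 (I • 1) (-(I • 1)) : Matrix (l ⊕ l) (l ⊕ l) ℂ) =
      Matrix.of fun p q : l ⊕ l =>
        if q = Sum.elim (fun i => if 0 < t i then (Sum.inl i : l ⊕ l) else Sum.inr i) (fun i => if 0 < t i then (Sum.inr i : l ⊕ l) else Sum.inl i) p then
          ((Real.sqrt (|t (Sum.elim id id p)| / 2) : ℂ))⁻¹ else 0 := by
  rw [frameInv_mul_cayley, letters_P₀_sub_I_P₁, letters_P₀_add_I_P₁]
  have hadd : ∀ i, (((1 + t i / |t i|) * (Real.sqrt (|t i| / 2))⁻¹ / 2 : ℝ) : ℂ) = if 0 < t i then ((Real.sqrt (|t i| / 2) : ℂ))⁻¹ else 0 := by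
    intro i
    rw [mul_div_assoc, one_add_sign_mul t ht]
    by_cases hi : 0 < t i
    · rw [if_pos hi, if_pos hi]; push_cast; ring
    · rw [if_neg hi, if_neg hi]
  have hsub : ∀ i, (((1 - t i / |t i|) * (Real.sqrt (|t i| / 2))⁻¹ / 2 : ℝ) : ℂ) = if 0 < t i then 0 else ((Real.sqrt (|t i| / 2) : ℂ))⁻¹ := by
    intro i
    rw [mul_div_assoc, one_sub_sign_mul t ht]
    by_cases hi : 0 < t i
    · rw [if_pos hi, if_pos hi]
    · rw [if_neg hi, if_neg hi]; push_cast; ring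
  ext p q
  rcases p with i | i <;> rcases q with j | j <;>
    simp only [fromBlocks_apply₁₁, fromBlocks_apply₁₂, fromBlocks_apply₂₁, fromBlocks_apply₂₂, diagonal_apply, Matrix.of_apply, Sum.elim_inl, Sum.elim_inr, id] <;>
    by_cases hij : i = j
  · subst hij
    rw [if_pos rfl, hadd]
    by_cases hi : 0 < t i
    · rw [if_pos hi, if_pos hi, if_pos rfl]
    · rw [if_neg hi, if_neg hi, if_neg Sum.inl_ne_inr]
  · rw [if_neg hij]
    by_cases hi : 0 < t i
    · rw [if_pos hi, if_neg (fun h => hij (Sum.inl_injective h).symm)]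
    · rw [if_neg hi, if_neg Sum.inl_ne_inr]
  · subst hij
    rw [if_pos rfl, hsub]
    by_cases hi : 0 < t i
    · rw [if_pos hi, if_pos hi, if_neg Sum.inr_ne_inl]
    · rw [if_neg hi, if_neg hi, if_pos rfl]
  · rw [if_neg hij]
    by_cases hi : 0 < t i
    · rw [if_pos hi, if_neg Sum.inr_ne_inl]
    · rw [if_neg hi, if_neg (fun h => hij (Sum.inr_injective h).symm)]
  · subst hij
    rw [if_pos rfl, hsub]
    by_cases hi : 0 < t i
    · rw [if_pos hi, if_pos hi, if_neg Sum.inl_ne_inr]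
    · rw [if_neg hi, if_neg hi, if_pos rfl]
  · rw [if_neg hij]
    by_cases hi : 0 < t i
    · rw [if_pos hi, if_neg Sum.inl_ne_inr]
    · rw [if_neg hi, if_neg (fun h => hij (Sum.inl_injective h).symm)]
  · subst hij
    rw [if_pos rfl, hadd]
    by_cases hi : 0 < t i
    · rw [if_pos hi, if_pos hi, if_pos rfl]
    · rw [if_neg hi, if_neg hi, if_neg Sum.inr_ne_inl]
  · rw [if_neg hij]
    by_cases hi : 0 < t i
    · rw [if_pos hi, if_neg (fun h => hij (Sum.inr_injective h).symm)]
    · rw [if_neg hi, if_neg Sum.inr_ne_inl]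

/-! ## §2 The conjugation formula -/

/-- **`T⁻¹ (T₁ M ½T₁′) T = (d_{p̄}⁻¹ · M(π p, π q) · d_{q̄})_{pq}`** for EVERY matrix `M` — the tube frame carries the whole Cayley chart to `M` relabelled by the slot
involution `π` and rescaled (§1; `Finset.sum_ite_eq′`). [cite: Shimura1997, §6.5] [cite: KonnoKonno2007, §3.1] -/
theorem frameInv_cayley_conj_frame (t : l → ℝ) (ht : ∀ i, t i ≠ 0) (M : Matrix (l ⊕ l) (l ⊕ l) ℂ) :
    fromBlocks (diagonal (fun i => (((Real.sqrt (|t i| / 2))⁻¹ / 2 : ℝ) : ℂ))) (-diagonal (fun i => I * ((((Real.sqrt (|t i| / 2))⁻¹ * (t i / |t i|) / 2 : ℝ) : ℂ))))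
        (diagonal (fun i => (((Real.sqrt (|t i| / 2))⁻¹ / 2 : ℝ) : ℂ))) (diagonal (fun i => I * ((((Real.sqrt (|t i| / 2))⁻¹ * (t i / |t i|) / 2 : ℝ) : ℂ)))) *
        ((fromBlocks 1 1 (I • 1) (-(I • 1)) : Matrix (l ⊕ l) (l ⊕ l) ℂ) * M * ((2 : ℂ)⁻¹ • fromBlocks 1 (-(I • 1)) 1 (I • 1))) *
        fromBlocks (diagonal (fun i => (Real.sqrt (|t i| / 2) : ℂ))) (diagonal (fun i => (Real.sqrt (|t i| / 2) : ℂ)))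
          (diagonal (fun i => I * (((t i / |t i|) * Real.sqrt (|t i| / 2) : ℝ) : ℂ))) (-diagonal (fun i => I * (((t i / |t i|) * Real.sqrt (|t i| / 2) : ℝ) : ℂ))) =
      Matrix.of fun p q : l ⊕ l =>
        ((Real.sqrt (|t (Sum.elim id id p)| / 2) : ℂ))⁻¹ * M (Sum.elim (fun i => if 0 < t i then (Sum.inl i : l ⊕ l) else Sum.inr i) (fun i => if 0 < t i then (Sum.inr i : l ⊕ l) else Sum.inl i) p) (Sum.elim (fun i => if 0 < t i then (Sum.inl i : l ⊕ l) else Sum.inr i) (fun i => if 0 < t i then (Sum.inr i : l ⊕ l) else Sum.inl i) q) * (Real.sqrt (|t (Sum.elim id id q)| / 2) : ℂ) := by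
  rw [show fromBlocks (diagonal (fun i => (((Real.sqrt (|t i| / 2))⁻¹ / 2 : ℝ) : ℂ))) (-diagonal (fun i => I * ((((Real.sqrt (|t i| / 2))⁻¹ * (t i / |t i|) / 2 : ℝ) : ℂ))))
        (diagonal (fun i => (((Real.sqrt (|t i| / 2))⁻¹ / 2 : ℝ) : ℂ))) (diagonal (fun i => I * ((((Real.sqrt (|t i| / 2))⁻¹ * (t i / |t i|) / 2 : ℝ) : ℂ)))) *
        ((fromBlocks 1 1 (I • 1) (-(I • 1)) : Matrix (l ⊕ l) (l ⊕ l) ℂ) * M * ((2 : ℂ)⁻¹ • fromBlocks 1 (-(I • 1)) 1 (I • 1))) *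
        fromBlocks (diagonal (fun i => (Real.sqrt (|t i| / 2) : ℂ))) (diagonal (fun i => (Real.sqrt (|t i| / 2) : ℂ)))
          (diagonal (fun i => I * (((t i / |t i|) * Real.sqrt (|t i| / 2) : ℝ) : ℂ))) (-diagonal (fun i => I * (((t i / |t i|) * Real.sqrt (|t i| / 2) : ℝ) : ℂ))) =
      (fromBlocks (diagonal (fun i => (((Real.sqrt (|t i| / 2))⁻¹ / 2 : ℝ) : ℂ))) (-diagonal (fun i => I * ((((Real.sqrt (|t i| / 2))⁻¹ * (t i / |t i|) / 2 : ℝ) : ℂ))))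
        (diagonal (fun i => (((Real.sqrt (|t i| / 2))⁻¹ / 2 : ℝ) : ℂ))) (diagonal (fun i => I * ((((Real.sqrt (|t i| / 2))⁻¹ * (t i / |t i|) / 2 : ℝ) : ℂ)))) *
        (fromBlocks 1 1 (I • 1) (-(I • 1)) : Matrix (l ⊕ l) (l ⊕ l) ℂ)) * M *
      (((2 : ℂ)⁻¹ • fromBlocks 1 (-(I • 1)) 1 (I • 1) : Matrix (l ⊕ l) (l ⊕ l) ℂ) *
        fromBlocks (diagonal (fun i => (Real.sqrt (|t i| / 2) : ℂ))) (diagonal (fun i => (Real.sqrt (|t i| / 2) : ℂ)))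
          (diagonal (fun i => I * (((t i / |t i|) * Real.sqrt (|t i| / 2) : ℝ) : ℂ))) (-diagonal (fun i => I * (((t i / |t i|) * Real.sqrt (|t i| / 2) : ℝ) : ℂ)))) by
    simp only [Matrix.mul_assoc], frameInv_mul_cayley_eq_perm t ht, cayleyInv_mul_frame_eq_perm t ht]
  ext p q
  simp only [Matrix.mul_apply, Matrix.of_apply, ite_mul, zero_mul, mul_ite, mul_zero, Finset.sum_ite_eq', Finset.mem_univ, if_true]

end Summit.HodgeConjecture.HodgeConjecture.Cruxes.HLiu418.K2LiuArchReadingChartPlaceSec
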